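import Summits.PneNP.PneNP.Theorems.ExpanderLinearGeneratorsResKRung
import Summits.PneNP.PneNP.Theorems.ExpanderLinearGeneratorsGeneratorRegime
import HarnessLib

/-!
# The `Res(k)` rung for expanding linear systems, XV: Krajíček's Problem 19.4.5 for `R(k')`,
random sparse `n² × n` generators (unconditional)

Support file for `stmt-PneNP-11443`. The session-10 calibration
`RandomExpander.generatorHard_of_linearGeneratorDepthFregeHard` ("crux ⇒ Problem 19.4.5 for almost
all sparse `n² × n` matrices") one level down the ladder, now UNCONDITIONAL
(`generator_resK_hard`): for `0 < δ`, `k ≥ 1` with `δk ≥ 3`, and `1 ≤ k'`, `k' ≤ 3k`,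
`δ (k'² + k' + 2) < 2`, there is `ε > 0` such that for all large `n`, all but a
`2 e^{7k} (7k)^k / n`-fraction of the pick functions `f : Fin n² × Fin (8k) → Fin n` (the rows of an
`8k`-sparse `n² × n` matrix `A_f`) satisfy: for EVERY right-hand side `b`, EVERY `R(k')`-refutation
of `τ_b(A_f) = sumEncoding 1 (A_f ∣ b)` has at least `2^{n^ε}` lines. These are the generators of
Krajíček's Theorem 13.3.1 / Problem 19.4.5; the `R(k')` case (constant `k'`) is thereby settled in
the tree, the `AC⁰`-Frege case being the crux.

[Krajíček 2019, Thm. 13.3.1, §13.4, Problem 19.4.5; Alekhnovich 2011; Segerlind–Buss–Impagliazzo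
2004]
-/

namespace Summit.PneNP.PneNP.Theorems.ResKRestriction

open Finset Literature.Computability.Complexity Literature.Computability.MetaComplexity
open Summit.PneNP.PneNP.Theorems.RandomExpander

open scoped Classical in
/-- **Problem 19.4.5 for `R(k')`, random sparse generators (unconditional).** For `0 < δ`,
`k ≥ 1`, `δk ≥ 3`, `1 ≤ k' ≤ 3k` and `δ (k'² + k' + 2) < 2` there is `ε > 0` such that for all
large `n` the number of pick functions `f : Fin n² × Fin (8k) → Fin n` for which SOME right-hand
side `b` admits an `R(k')`-refutation of `sumEncoding 1 (A_f ∣ b)` with fewer than `2^{n^ε}` lines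
is at most `2 (e^{7k} (7k)^k / n) · n^{n² · 8k}` — an `O_k(1/n)`-fraction of all of them.
[Krajíček 2019, Problem 19.4.5, Thm. 13.3.1; Alekhnovich 2011, Thm. 1.2]
[cite: KrajicekProofComplexity2019, Problem 19.4.5] -/
theorem generator_resK_hard {δ : ℝ} (hδ : 0 < δ) {k : ℕ} (hk : 1 ≤ k) (hδk : 3 ≤ δ * k)
    {k' : ℕ} (hk'1 : 1 ≤ k') (hk' : k' ≤ 3 * k) (hδk' : δ * ((k' : ℝ) ^ 2 + k' + 2) < 2) :
    ∃ ε : ℝ, 0 < ε ∧ ∃ N : ℕ, ∀ n : ℕ, N ≤ n →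
      ((Finset.univ.filter fun f : Fin (n ^ 2) × Fin (8 * k) → Fin n =>
        ¬ ∀ b : Fin (n ^ 2) → ZMod 2,
          ∀ π : List (ResKLine ℕ), IsResKRefutation k'
            (sumEncoding 1
              (fun i => ((fun j => if j ∈ (Finset.univ.image fun t => f (i, t))
                then (1 : ZMod 2) else 0), b i))) π →
            (2 : ℝ) ^ ((n : ℝ) ^ ε) ≤ (resKSize π : ℝ)).card : ℝ)
      ≤ 2 * (Real.exp (7 * k) * (7 * k : ℝ) ^ k / n) * (n : ℝ) ^ (n ^ 2 * (8 * k)) := by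
  classical
  obtain ⟨ε, hε, N₁, hN₁⟩ := resK_lowerBound_expander (8 * k) k' δ hk'1 (by omega) hδ hδk'
  obtain ⟨N₂, hN₂⟩ := brackets_generator hδ hk hδk
  refine ⟨ε, hε, max N₁ N₂, fun n hn => ?_⟩
  obtain ⟨hn0, -, hR, hq4, hq⟩ := hN₂ n ((le_max_right _ _).trans hn)
  have hq' : ∀ s ∈ Finset.Icc 1 ⌊(n : ℝ) ^ (1 - δ)⌋₊,
      (((n ^ 2 : ℕ) : ℕ) : ℝ) * Real.exp (7 * k) * ((((7 * k * s : ℕ) : ℝ) / n) ^ k) ≤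
        Real.exp (7 * k) * (7 * k : ℝ) ^ k / n := hq
  refine le_trans ?_ (card_not_coverExpanding_le k (n ^ 2) n _ hn0 hR (by positivity)
    (by linarith) hq')
  -- a cover-expanding `f` satisfies the conclusion, by the `Res(k')` rung
  refine Nat.cast_le.2 (Finset.card_le_card fun f hf => ?_)
  rw [Finset.mem_filter] at hf ⊢
  refine ⟨hf.1, fun hce => hf.2 fun b π hπ => ?_⟩
  obtain ⟨-, hexp⟩ := hyps_of_picks f hce
    (fun i => ((fun j => if j ∈ (Finset.univ.image fun t => f (i, t)) then (1 : ZMod 2) else 0),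
      b i)) (fun i => rfl)
  exact hN₁ n ((le_max_left _ _).trans hn) (n ^ 2) _ (isBoundaryExpander_of_floor _ hexp) π hπ

end Summit.PneNP.PneNP.Theorems.ResKRestriction
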